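import Literature.AlgebraicGeometry.HodgeTheory.SecantQuotientAnchorTwistedCarrier
import Literature.AlgebraicGeometry.Markman2025.SecantQuotientCarrier
import Literature.AlgebraicGeometry.Markman2025.SecantQuotientPolarization
import HarnessLib

/-!
# Markman's secant quotient `(J × Ĵ)/Ḡ` OF A GENUS-3 JACOBIAN carries a pinned twisted carrier of Weil shape — the IDENTIFIED
# object-level form of arXiv:2502.03415 at the anchor, on the tree's real carriers

Family `hodge`, layer `Literature/AlgebraicGeometry/HodgeTheory`. Requested by road b02 (`Summits/HodgeConjecture/HodgeConjecture/
Theses/VHCAbelianSchemesRoad.lean`, crux stmt-HodgeConjecture-19787, the `(6, 3)` rung; ring2 LEAD gen 152 ruling L152.1 «skeleton v3 PROPER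
over the GEOMETRIC secant-quotient anchor», 2026-08-27). Companion and REFINEMENT of `SecantQuotientAnchorTwistedCarrier.lean` (same seat,
gen 86): there the anchor sixfold `Y`, the split Weil sixfold `P`, the operator `ψ₀` and the isogeny `q` are EXISTENTIALLY quantified
abelian varieties and morphisms; HERE they are THE CARRIER OBJECTS of `Markman2025/SecantQuotientCarrier.lean` (typer seat
`hodge-lit-avcarriers`, p503739): `P = J × Ĵ` (`𝒥.J.prod (𝒥.J.dualOf Θ _)` for a Jacobian `𝒥` of a smooth projective complex curve with
`dim J = 3`, principally polarised by a Riemann theta divisor `Θ`), `ψ₀ = Markman2025.weilOperator` (`φ_d : (x, y) ↦ (-d·φ_Θ⁻¹ y, φ_Θ x)`,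
`φ_d ≫ φ_d = -d` a THEOREM there), `Y = Markman2025.secantQuotient` (`(J × Ĵ)/Ḡ`, `Ḡ` the Rouquier image of cyclic `G₁, G₂ ≤ J[d+1](ℂ)`),
`q = Markman2025.secantQuotientMap` (the quotient isogeny, `q^*` bijective on complex cohomology — a THEOREM there). Three declarations:

* `HasTwistedCarrierOnSecantQuotient C Adm A hΘ hK G₁ G₂ hn h₁ h₂ d` (a PREDICATE, real definition) — for ANY complex abelian variety `A`
  with an ample `Θ` with `K(Θ) = 0` and subgroups `G₁, G₂ ≤ A[n](ℂ)`: on the secant quotient `Y = (A × Â)/Ḡ` there are a polarisation class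
  `θ ∈ H²(Y(ℂ); ℂ)` — `IsPolarizationClass 6 Y θ`, on the line of an AMPLE divisor of `Y` (`IsPolarizationClassOf`), with `(A × Â, φ_d)` of
  HYPERBOLIC Weil type for `q^*θ` — and a RATIONAL class `γ ∈ H⁶(Y(ℂ); ℂ)` OFF the ray `ℂ·θ³` with `q^*γ` a Weil class of `(A × Â, φ_d)` in
  degree `6` (`weilClassesOf _ φ_d 3 d`), such that ON EVERY COPY `e : X' ≅ Y` there is a member `(I ∋ 3, κ)` of the object class
  `twistedReflexiveClass C Adm 6 X'` (`B`-twisted `Adm`-admissible bounded complexes of vector bundles, road item D1) PINNED to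
  `(e^*θ, e^*γ)`: `κ₃ = e^*γ + c₃·(e^*θ)³`, `κ_k = c_k·(e^*θ)ᵏ` (`k ∈ I`, `k ≠ 3`). The clauses on `(θ, γ)` are VERBATIM those of the road's
  geometric anchor predicate `IsSecantQuotientWeilClassAt` (`Summits/…/Theorems/VHCAbelianSchemesRoadSecantQuotientAnchorDefs.lean`, ring2
  LEAD gen 152) read at the identity chart; the datum clause is VERBATIM that of `HasSecantCarrierWeilAnchor`.
* `Markman2025_secantQuotient_twistedCarrier_onJacobian C Adm` (NAMED CLAIM-FACT, source UNREFEREED): for every EVEN `d ≥ 4` THERE ARE a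
  smooth projective complex curve `Cᵥ`, a Jacobian `𝒥` of `Cᵥ` with `dim J = 3`, a Riemann theta divisor `Θ` of `𝒥` which is a principal
  polarization divisor, cyclic subgroups `G₁, G₂ ≤ J[d+1](ℂ)` of order `d+1` with `G₁ ⊓ G₂ = ⊥` whose `(d+1)²` theta translates
  `τ_{g₁+g₂}(Θ)` are in general position (`Markman2025.TranslatesInGeneralPosition`, Lemma 9.3.1) — EXACTLY the fields of the road's
  `SecantQuotientDatum` — such that `HasTwistedCarrierOnSecantQuotient C Adm 𝒥.J … G₁ G₂ … d`. ∃-FORM over print's construction data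
  (print: a GENERIC non-hyperelliptic `C` and `G₁, G₂` as in Lemma 9.3.1 — existence, not «for all»): the universally quantified form over
  the typable envelope would assert MORE than print (genericity / non-hyperellipticity are not typable; road gap (G1)) and is NOT stated.
* (proved ROAD-SIDE, `Summits/HodgeConjecture/HodgeConjecture/Theorems/VHCAbelianSchemesRoadSecantQuotientAnchorMarkman.lean`, so that
  this file stays statement-only): the claim-fact here implies the existential claim-fact `Markman2025_secantQuotientAnchor_twistedCarrier_sixfold`
  of the companion file (`P := J × Ĵ`, `Y := (J × Ĵ)/Ḡ`, `ψ₀ := φ_d`, `q := q`; the dimension and bijectivity clauses are the carrier file's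
  theorems) — the identified form REFINES the existential one, same witness.

## Source, verbatim (held text `paper:arxiv-2502.03415`, E. Markman, *Cycles on abelian 2n-folds of Weil type from secant sheaves on
## abelian n-folds*, arXiv:2502.03415 v2, UNREFEREED — tagged `[claim …]`; corpus numbering in brackets where it differs)

Thm. 1.4.1 (p. 6): "`X` is the Jacobian `Pic²(C)` of a genus `3` non-hyperelliptic curve `C`, `F₁ = 𝓘_{∪_{i=1}^{d+1}Cᵢ}(Θ)` […] `d+1` generic
translates `Cᵢ ⊂ X` of the Abel Jacobi image `AJ(C)` […] `F₂ = 𝓘_{∪Σᵢ}(Θ)`, where `Σᵢ ⊂ X` is a generic translate of `-AJ(C)`. Set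
`u := √-d Θ`, `d ≥ 3`. […] • The dual object `Φ(F₂ ⊠ F₁)^∨` is isomorphic to `𝓔[-2]`, where `𝓔` is a simple reflexive sheaf of rank `8d` over
`X × X̂` […] • The `η(K)`-translates of the graded summand `κ₃(𝓔)` of `κ(𝓔)` in `H^{3,3}(X × X̂, ℚ)`, together with `h³`, span the
3-dimensional subspace `ℚh³ ⊕ ĤW_P`." §1.5 (p. 7): "The sheaf `𝓔` in the theorem is not semiregular. […] Let `G₁` and `G₂` be cyclic subgroups
of `X` of order `d+1` with `G₁ ∩ G₂ = (0)`. Choose `Cᵢ ⊂ X` […] to be a `G₁`-orbit of translates of […] `AJ(C)` […] `Σᵢ` […] a `G₂`-orbit of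
translates of `-AJ(C)` […] Denote by `Ḡ` the image of `G` via the projection to the cartesian factor `X × X̂`. […] Let
`q : X × X̂ → Y := (X × X̂)/Ḡ` be the quotient morphism. When `d` is even […] we can replace `𝓔` by its tensor product with a suitable power of
the line bundle `det(𝓔)` to get a `Ḡ`-equivariant sheaf `𝓔̃`. The latter descends to a semiregular reflexive sheaf `𝓔̄` over `Y` satisfying
`q^*𝓔̄ = 𝓔̃`. Finally, we associate to `𝓔̄` a reflexive sheaf `𝓑`, twisted by a Čech 2-cocycle with coefficients in `μ_{8d}` and with a trivial
determinant line bundle, satisfying `κ(𝓔) = q^*κ(𝓑)`." §1.3 (p. 5): "the subspace `H²(X × X̂, ℚ)^{Spin(V)_P}` is one-dimensional spanned by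
an ample class `h`". §2.4 (pp. 15–17): "`f := cm_{√-d}` […] `f² = -d` […] `Ξ_P(x, y) := (f(x), y)_V`", "`θ : H¹(X, ℚ)^* → H¹(X, ℚ)` be contraction
with `Θ` […] `-θ` is the pullback homomorphism associated to the isogeny `φ_L : X → X̂`", Prop. 2.4.4 (`g_P` definite, so `Ξ_P` is a polarisation);
proof of Lemma 3.1.3 (p. 19): "`2f(0, y) = […] = (2dθ(y), 0)`", "the discriminant of the hermitian form `H` is `(-1)ⁿ`". Cor. 1.3.2 / Cor. 4.0.4
[corpus 4.0.7]: `κ(𝓔)` is `Spin(V)_P`-invariant; the invariant subring is `ℚ[h] ⊕` (the rational 2-plane of Hodge–Weil classes). §9.1–9.3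
(pp. 57, 60, 70–74): "Let `C` be a non-hyperelliptic curve of genus `3`"; Assumption 9.1.1 and Lemma 9.1.2 ("holds for `d ≥ 3` for a generic
choice of `Cᵢ`'s"); Assumption 9.2.1; Prop. 9.2.2 (`𝓔` reflexive of rank `8d`, locally free off `Θ̃`); Lemma 9.3.1 ("A generic `C` admits
subgroups `G₁` and `G₂` of `Pic⁰(C)`, such that Assumption 9.2.1 holds […] it suffices to prove the existence of `G₁` and `G₂`, such that the
intersection of any four translates `τ_{g₁+g₂}(Θ)`, `(g₁, g₂) ∈ G₁ × G₂`, is empty and any three translates have finite intersection");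
Lemma 9.3.3 (`G ≅ Ḡ`, the element `(τ_{x₁-x₂}, τ_{L_{x₁+x₂}})`); Lemma 9.3.4/9.3.5 + footnote and Remark 9.3.7 (`d` even: the Brauer class of
`𝓑` is trivial, `𝓑 = 𝓔̄ ⊗ det^{-1/8d}`, `𝓔̄` untwisted reflexive); eq. after Lemma 9.3.6 (`q^*κ(𝓑) = ch(𝓔)exp(-c₁(𝓔)/r)`); Lemma 9.3.11 ("The
twisted reflexive sheaf `𝓑` is semiregular"; proof, p. 74: "the arrows labeled `q^*` are all isomorphisms").

## Rendering of the claim-fact (witness, regime, and what is RENDERING GLUE — read before citing)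

REGIME: `d` EVEN, `d ≥ 4` ONLY, as in the companion file (untwisted descent `𝓔̄`; no `d ↦ 4d` transport asserted).

WITNESS. Data: Markman's generic non-hyperelliptic genus-3 curve `C` with its Jacobian `J = Pic⁰(C) ≅ Pic²(C) = X` (`dim J = 3`), the Riemann
theta divisor `Θ = W₂` (a principal polarization divisor — Riemann's theorem, the tree's named fact
`Motives.Jacobian.riemann_brillNoetherLocus_isPrincipalPolarizationDivisor`, classical), and `G₁, G₂` as in Lemma 9.3.1 (cyclic of order
`d+1` in `J[d+1]`, `G₁ ∩ G₂ = 0`, translates in general position); the carrier file's `rouquierImage` IS Markman's `Ḡ` (its docstring,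
Lemma 9.3.3) and `secantQuotient` IS `Y = (X × X̂)/Ḡ`, `secantQuotientMap` IS `q`. THE OPERATOR (rendering glue (g5), a TRANSPORT): Markman's
`f = η(√-d)` acts on `V = H¹(X) ⊕ H¹(X̂)` by `f(u, ξ) = (d·θξ, -θ⁻¹u)` (p. 19 with p. 16's `θ = -φ_Θ^*`), i.e. `f = g^*` for the endomorphism
`g(x, y) = (φ_Θ⁻¹ y, -d·φ_Θ x)` of `X × X̂`; the carrier file's `φ_d(x, y) = (-d·φ_Θ⁻¹ y, φ_Θ x)` is `σ ∘ g ∘ σ⁻¹` for the AUTOMORPHISM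
`σ(x, y) := (φ_Θ⁻¹ y, φ_Θ x)` of `X × X̂` (`σ² = 1`; `g(σ(x, y)) = (x, -d·y)`), and `σ(Ḡ) = Ḡ` (`σ(x₁ - x₂, φ_Θ(x₁ + x₂)) = (x₁ + x₂, φ_Θ(x₁ - x₂))`,
`-x₂ ∈ G₂`), so `σ` descends to an automorphism `σ̄` of `Y` with `q ∘ σ = σ̄ ∘ q` (up to the orientation `√-d ↦ -√-d`, which replaces `g` by `-g`
and changes neither the Weil plane nor the compatible polarisations nor hyperbolicity). Print's objects at `(X × X̂, f)`: the invariant ample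
class `Ξ_P` (`∝ d·p₁^*Θ + p₂^*Θ̂`, `Θ̂ := (φ_Θ^*)⁻¹Θ`; `f^*Ξ_P = d·Ξ_P`), its descent `h` (`q^*h = Ξ_P`; §1.3), the Weil plane `ĤW_P = ĤW_f`, the
sheaf `𝓔̄` on `Y`. THE CLASSES OF THE CLAIM: `θ := σ̄^*h`, `γ := σ̄^*γ₀` with `γ₀ := (q^*)⁻¹w₀`, `w₀ ∈ ĤW_f` the (rational, non-zero — Thm. 1.4.1
item 4) Weil component of `κ₃(𝓔)`; THE DATUM: `E• :=` a finite locally free resolution of `σ̄^*𝓔̄` (smooth projective `Y`), `B₀ := -c₁(σ̄^*𝓔̄)/8d`,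
`I := {1, …, 6}`, `κ = σ̄^*κ(𝓔̄) = σ̄^*κ(𝓑)`. CHECKS: `q^*θ = σ^*Ξ_P ∝ p₁^*Θ + d·p₂^*Θ̂` is `φ_d`-compatible and `(X × X̂, φ_d)` is hyperbolic for
it (transport of Lemma 3.1.3 along `σ`: `φ_d^* σ^* = σ^* f^*` since `σ^*σ^* = 1`; isotropy by naturality of the polarisation pairing); `θ` lies
on the line of an ample divisor of `Y` and is a polarisation class (the norm along the finite étale `q` of an ample `L` with `c₁(L) = Ξ_P`
is ample on `Y` with `q^*c₁ = (d+1)²·Ξ_P`, translations acting trivially on `H²`; hard Lefschetz for an ample class, Voisin I Thm. 6.25 —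
glue (g4)); `q^*γ = σ^*w₀ ∈ σ^*ĤW_f = ĤW_{φ_d} = weilClassesOf (X × X̂) φ_d 3 d` (eigenclasses transport along `σ`); `γ ∉ ℂ·θ³` (`w₀ ∉ ℂ·Ξ_P³`:
`f^*` acts by `-d³` on `ĤW_f` and by `d³` on `Ξ_P³`); `κ₃ = γ + c₃θ³`, `κ_k = c_kθᵏ` (Cor. 1.3.2 + Cor. 4.0.4 transported by `σ̄^*`); `σ̄^*𝓔̄` is
semiregular (pull-back of a semiregular sheaf along an automorphism). ON EVERY COPY `e : X' ≅ Y`: the same transported along `e` (the anchor is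
an isomorphism class; the companion files quantify over charts in the same way).

ADMISSIBILITY (the schema parameter `Adm`): as in the companion file — INTENDED notion = full semiregularity of `E• ≃ σ̄^*𝓔̄[0]` plus
`Ext^{<0}(E•, E•) = 0`; faithful for every weaker notion (e.g. the road's `gluableSigmaAdmissible ∨ bfSingleAdmissible`), OVER-REACHING for notions
demanding a vector bundle in degree `0` (`𝓔̄` is reflexive, locally free only off `Θ̃`, Prop. 9.2.2). RENDERING GLUE (standard, not sentences
of the source): (g1) `σ` of a strictly perfect resolution = `σ` of the sheaf; (g2) `Ext^{<0}` of a sheaf vanishes; (g3) `q^*` bijective for an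
isogeny (HERE a theorem of the carrier file); (g4) ampleness / hard Lefschetz of the descended class; (g5) transport along the automorphism
`σ̄` of `Y` (above); (g6) EXISTENCE inputs of the ∃-form: non-hyperelliptic genus-3 curves exist, their Jacobians in the sense of the tree's
`Motives.Jacobian` exist (Milne, *Jacobian Varieties*, Thm. 1.1 / Prop. 6.4), `J[d+1](ℂ) ≅ (ℤ/(d+1))⁶` contains cyclic subgroups of order `d+1`
meeting trivially, and print's Lemma 9.3.1 supplies the general position for generic `C`.

WHAT IS NOT CLAIMED: the universal form over the envelope (any curve, any `G₁, G₂` — road gap (G1)); carriers for the OTHER rational directions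
of `ℚθ³ ⊕ (Weil plane)` (print serves ONE direction per construction; Thm. 1.4.1 item 4 spans by `η(K)`-translates at CLASS level only — road
gap (G3)); anything at the members of the Weil-type component other than `Y_d` (print: algebraicity by deformation + Baire, no carrier);
anything about `X × X̂` itself (`𝓔` is NOT semiregular); that the road's anchored-carrier statement (a′) `SecantQuotientAnchorCarrier63` follows
(it does NOT: (G1)–(G3)). Nothing here asserts HC, `HC_AV`, VHC or any statement of `Summits/`.

## References

* [Markman2025SecantWeil] E. Markman, arXiv:2502.03415 v2 (2025): §1.3, Cor. 1.3.2, Thm. 1.4.1, §1.5, §2.4 with Prop. 2.4.4, Lemma 3.1.3 and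
  its proof, Cor. 4.0.4 (corpus 4.0.7), §9.1 Assumption 9.1.1 / Lemma 9.1.2, §9.2 Assumption 9.2.1 / Prop. 9.2.2, §9.3 Lemma 9.3.1, 9.3.3–9.3.6,
  Remark 9.3.7, Lemma 9.3.11 and its proof. UNREFEREED.
* [BuchweitzFlenner2003] R.-O. Buchweitz, H. Flenner, Compositio Math. 137 (2003), Def. 4.1 and §5.
* [Perry2026Semiregularity] arXiv:2604.00511, Thm. 1.1 (the `(E₀, B₀)` packaging; road item D1).
* [vanGeemen1994HodgeAV] B. van Geemen, LNM 1594 (1994), Lemma 5.2, 5.4, §3.6.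
* [VoisinHodgeI2002] C. Voisin, Hodge Theory and Complex Algebraic Geometry I, Thm. 6.25.
* [Milne1986JacobianVarieties] J. S. Milne, *Jacobian Varieties* (1986), Thm. 1.1, Prop. 6.4, Thm. 6.6.
* Tree: `Markman2025/SecantQuotientCarrier` (p503739), `Motives/JacobianThetaDivisor` (p502355), `Motives/AbelianVarietyDualQuotient` (p501591),
  `HodgeTheory/SecantQuotientAnchorTwistedCarrier` (p497016).
-/

noncomputable section

open CategoryTheory

namespace Literature.AlgebraicGeometry.HodgeTheory

open Literature.AlgebraicTopology.SingularHomology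
open Literature.AlgebraicGeometry.Motives Literature.AlgebraicGeometry.Markman2025

section HodgeTheory

/-- **The secant quotient `Y = (A × Â)/Ḡ` carries a PINNED `Adm`-admissible twisted carrier of Weil shape for the operator `φ_d`**
(`HasTwistedCarrierOnSecantQuotient C Adm A hΘ hK G₁ G₂ hn h₁ h₂ d`). For a complex abelian variety `A` with an ample `Θ` with `K(Θ) = 0`,
subgroups `G₁, G₂ ≤ A[n](ℂ)` and a level `d`: on `Y := Markman2025.secantQuotient A hΘ G₁ G₂ hn h₁ h₂` there are a class `θ ∈ H²(Y(ℂ); ℂ)`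
which is a polarisation class of the sixfold `Y` (`IsPolarizationClass 6`), lies on the line of an AMPLE divisor of `Y`
(`AbelianVariety.IsPolarizationClassOf`) and makes `(A × Â, φ_d)` (`φ_d = Markman2025.weilOperator hΘ hK d`) of HYPERBOLIC Weil type for `q^*θ`
(`q = Markman2025.secantQuotientMap …`), and a RATIONAL class `γ ∈ H⁶(Y(ℂ); ℂ)` OFF the ray `ℂ·θ³` with `q^*γ ∈ weilClassesOf (A × Â) φ_d 3 d`,
such that ON EVERY COPY `e : X' ≅ Y` there are `I ∋ 3`, `κ` with `twistedReflexiveClass C Adm 6 X' I κ` and scalars `c_k` with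
`κ₃ = e^*γ + c₃·(e^*θ)³`, `κ_k = c_k·(e^*θ)ᵏ` for `k ∈ I`, `k ≠ 3`. The `(θ, γ)`-clauses are those of the road's geometric anchor predicate
`IsSecantQuotientWeilClassAt` at the identity chart; the datum clause is that of `HasSecantCarrierWeilAnchor`. A plain predicate, no
statement by itself. [cite: Markman2025SecantWeil, §1.5 (p. 7), Thm. 1.4.1 and Lemma 3.1.3] [cite: Bloch1972Semiregularity, Remark (7.5)] -/
def HasTwistedCarrierOnSecantQuotient (C : ChernCharacterBetti) (Adm : PerfectAdmissibility)
    (A : AbelianVariety ℂ) {Θ : CartierDivisor A.X.left} (hΘ : Θ.IsAmple) (hK : A.KTheta Θ = ⊥)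
    (G₁ G₂ : Subgroup (A.Points ℂ)) {n : ℕ} (hn : n ≠ 0) (h₁ : G₁ ≤ A.torsionPoints ℂ n) (h₂ : G₂ ≤ A.torsionPoints ℂ n)
    (d : ℕ) : Prop :=
  ∃ (θ : complexBetti (secantQuotient A hΘ G₁ G₂ hn h₁ h₂).X 2)
    (γ : complexBetti (secantQuotient A hΘ G₁ G₂ hn h₁ h₂).X (2 * 3)),
    IsPolarizationClass 6 (secantQuotient A hΘ G₁ G₂ hn h₁ h₂).X θ ∧
    (∃ H : CartierDivisor (secantQuotient A hΘ G₁ G₂ hn h₁ h₂).X.left,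
      H.IsAmple ∧ (secantQuotient A hΘ G₁ G₂ hn h₁ h₂).IsPolarizationClassOf H θ) ∧
    IsHyperbolicWeilType (A.prod (A.dualOf Θ hΘ)) (weilOperator hΘ hK d) 3
      (complexBetti.map (secantQuotientMap A hΘ G₁ G₂ hn h₁ h₂).hom.hom.hom 2 θ) ∧
    IsRationalClass γ ∧ γ ∉ (ℂ ∙ cupPowTwo θ 3) ∧
    complexBetti.map (secantQuotientMap A hΘ G₁ G₂ hn h₁ h₂).hom.hom.hom (2 * 3) γ ∈
      weilClassesOf (A.prod (A.dualOf Θ hΘ)) (weilOperator hΘ hK d) 3 d ∧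
    ∀ (X' : SchemeOver ℂ) (e : X' ≅ (secantQuotient A hΘ G₁ G₂ hn h₁ h₂).X),
      ∃ (I : Finset ℕ) (κ : (k : ℕ) → complexBetti X' (2 * k)) (c : ℕ → ℂ),
        3 ∈ I ∧ twistedReflexiveClass C Adm 6 X' I κ ∧
        κ 3 = complexBetti.map e.hom (2 * 3) γ + c 3 • cupPowTwo (complexBetti.map e.hom 2 θ) 3 ∧
        ∀ k ∈ I, k ≠ 3 → κ k = c k • cupPowTwo (complexBetti.map e.hom 2 θ) k

/-- **Markman 2025 (arXiv:2502.03415, UNREFEREED), the IDENTIFIED object-level statement: for every EVEN `d ≥ 4` there are a smooth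
projective complex curve `Cᵥ`, a Jacobian `𝒥` of `Cᵥ` with `dim J = 3`, a Riemann theta divisor `Θ` of `𝒥` which is a principal
polarization divisor, and cyclic subgroups `G₁, G₂ ≤ J[d+1](ℂ)` of order `d+1` with `G₁ ⊓ G₂ = ⊥` and the `(d+1)²` translates
`τ_{g₁+g₂}(Θ)` in general position (Lemma 9.3.1), such that the secant quotient `Y_d = (J × Ĵ)/Ḡ` with the split Weil operator `φ_d`
carries a pinned `Adm`-admissible twisted carrier of Weil shape on every copy (`HasTwistedCarrierOnSecantQuotient`)** — print's `X = Pic²(C)`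
for a generic non-hyperelliptic genus-3 `C`, `G₁, G₂` of Lemma 9.3.1, the descended semiregular reflexive sheaf `𝓔̄` on `Y_d` (§1.5, Remark
9.3.7, Lemma 9.3.11) with `κ` in `ℚ[h] ⊕ ℚγ₀` (Cor. 1.3.2, Cor. 4.0.4 [corpus 4.0.7], Thm. 1.4.1 item 4), TRANSPORTED along the automorphism
`σ̄` of `Y_d` induced by `σ(x, y) = (φ_Θ⁻¹ y, φ_Θ x)` so that the operator is the carrier file's `φ_d = σ ∘ η(√-d) ∘ σ⁻¹` (module docstring,
glue (g5)). ∃-FORM over print's construction data (the universal form over the typable envelope is NOT print and is not stated); regime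
`d` even `≥ 4` only; the `Adm`-schema contract and the rendering glue (g1)–(g6) as in the module docstring. PREPRINT — UNREFEREED wherever
load-bearing. Users take `(h : Markman2025_secantQuotient_twistedCarrier_onJacobian C Adm)`. [claim: Markman2025SecantWeil, status: under-review] -/
def Markman2025_secantQuotient_twistedCarrier_onJacobian (C : ChernCharacterBetti) (Adm : PerfectAdmissibility) : Prop :=
  ∀ d : ℕ, Even d → 4 ≤ d →
    ∃ (Cᵥ : SchemeOver ℂ) (_ : IsSmoothProjective 1 Cᵥ) (𝒥 : Jacobian Cᵥ) (_ : 𝒥.J.dim = 3)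
      (Θ : CartierDivisor 𝒥.J.X.left) (_ : 𝒥.IsRiemannThetaDivisor Θ) (hP : 𝒥.J.IsPrincipalPolarizationDivisor Θ)
      (G₁ G₂ : Subgroup (𝒥.J.Points ℂ)) (h₁ : G₁ ≤ 𝒥.J.torsionPoints ℂ (d + 1 : ℕ))
      (h₂ : G₂ ≤ 𝒥.J.torsionPoints ℂ (d + 1 : ℕ)),
      IsCyclic G₁ ∧ Nat.card G₁ = d + 1 ∧ IsCyclic G₂ ∧ Nat.card G₂ = d + 1 ∧ G₁ ⊓ G₂ = ⊥ ∧
      TranslatesInGeneralPosition 𝒥.J Θ (sumSet G₁ G₂) ∧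
      HasTwistedCarrierOnSecantQuotient C Adm 𝒥.J hP.isAmple hP.KTheta_eq_bot G₁ G₂ (Nat.succ_ne_zero d) h₁ h₂ d

/-! ## The PINNED form (appended, seat b02 gen 88, for skeleton v3.1 of the road — ring2 LEAD ruling L152.4c)

The road's v3.1 narrows the anchor's polarisation from «any ample-line class `θ` making `(J × Ĵ, φ_d)` hyperbolic» (gap G2) to
**`θ = h_Y(θ₀)`**, the DESCENT of the closed-form Weil polarisation class `Ξ_d(θ₀) = p₁^*θ₀ + d·p₂^*θ̂₀`
(`Markman2025.secantPolarizationClass`, typer file `Markman2025/SecantQuotientPolarization.lean`, p507939) for a polarisation class `θ₀` of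
the theta divisor (`AbelianVariety.IsPolarizationClassOf Θ θ₀`). Print supports the pinning: Markman's `h` is THE generator (up to `ℚˣ`) of
the one-dimensional `Spin(V)_P`-invariant part of `H²(X × X̂, ℚ)` (§1.3; Prop. 2.4.4), i.e. `h = c·Ξ_P(f)` with `c ∈ ℚˣ` (the sign of
`c` absorbs Prop. 2.4.4's «`g_P` negative definite» and the `V ≅ V^*` convention of the typer's closed form); transported along the involution
`σ` of glue (g5), `q^*(σ̄^*h) = σ^*(c·Ξ_P(f)) = c·Ξ_d([Θ]) = Ξ_d(c·[Θ])` (`σ^*p₁^*[Θ] = p₂^*[Θ̂]`, `σ^*p₂^*[Θ̂] = p₁^*[Θ]`,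
`[Θ̂] = (φ_Θ⁻¹)^*[Θ]` = `dualClassOf` in the principal case; `ℂ`-linearity `weilPolarizationClass_smul`), hence `σ̄^*h = h_Y(θ₀)` for
`θ₀ := c·[Θ]` by the uniqueness of descent along `q^*` (`eq_secantPolarizationClass_of_map_eq`), and `θ₀` is a rational non-zero class on
the line of `ch(Θ)` — `IsPolarizationClassOf Θ θ₀`. So the witness of the ∃-claim above ALREADY has `θ = h_Y(θ₀)`; the pinned claim below
records it. Three declarations: the clause package `IsTwistedCarrierWeilPairOn … θ γ` for GIVEN classes (so that
`HasTwistedCarrierOnSecantQuotient … ↔ ∃ θ γ, IsTwistedCarrierWeilPairOn … θ γ` is `Iff.rfl`), the pinned predicate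
`HasPinnedTwistedCarrierOnSecantQuotient` (`∃ θ₀ γ, IsPolarizationClassOf Θ θ₀ ∧ IsTwistedCarrierWeilPairOn … (h_Y θ₀) γ`), and the pinned
claim-fact `Markman2025_secantQuotient_twistedCarrier_onJacobian_pinned` (same ∃-form over print's construction data; implies the unpinned one
by forgetting `θ₀` — proved road-side). [cite: Markman2025SecantWeil, §1.3 (p. 5), Prop. 2.4.4, §3.2 Cor. 3.2.3 and §1.5] -/

/-- **The clause package of `HasTwistedCarrierOnSecantQuotient` for GIVEN classes `(θ, γ)` on `Y = (A × Â)/Ḡ`** (`IsTwistedCarrierWeilPairOn …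
d θ γ`): `θ` a polarisation class of the sixfold `Y` on the line of an ample divisor with `(A × Â, φ_d)` hyperbolic for `q^*θ`; `γ` rational,
off `ℂ·θ³`, `q^*γ` a Weil class of `(A × Â, φ_d)` in degree `6`; and on every copy `e : X' ≅ Y` a pinned `Adm`-datum `κ₃ = e^*γ + c₃(e^*θ)³`,
`κ_k = c_k(e^*θ)ᵏ`. VERBATIM the body of `HasTwistedCarrierOnSecantQuotient` with its two leading `∃` removed. A plain predicate.
[cite: Markman2025SecantWeil, §1.5 (p. 7), Thm. 1.4.1 and Lemma 3.1.3] [cite: Bloch1972Semiregularity, Remark (7.5)] -/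
def IsTwistedCarrierWeilPairOn (C : ChernCharacterBetti) (Adm : PerfectAdmissibility)
    (A : AbelianVariety ℂ) {Θ : CartierDivisor A.X.left} (hΘ : Θ.IsAmple) (hK : A.KTheta Θ = ⊥)
    (G₁ G₂ : Subgroup (A.Points ℂ)) {n : ℕ} (hn : n ≠ 0) (h₁ : G₁ ≤ A.torsionPoints ℂ n) (h₂ : G₂ ≤ A.torsionPoints ℂ n)
    (d : ℕ) (θ : complexBetti (secantQuotient A hΘ G₁ G₂ hn h₁ h₂).X 2)
    (γ : complexBetti (secantQuotient A hΘ G₁ G₂ hn h₁ h₂).X (2 * 3)) : Prop :=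
  IsPolarizationClass 6 (secantQuotient A hΘ G₁ G₂ hn h₁ h₂).X θ ∧
    (∃ H : CartierDivisor (secantQuotient A hΘ G₁ G₂ hn h₁ h₂).X.left,
      H.IsAmple ∧ (secantQuotient A hΘ G₁ G₂ hn h₁ h₂).IsPolarizationClassOf H θ) ∧
    IsHyperbolicWeilType (A.prod (A.dualOf Θ hΘ)) (weilOperator hΘ hK d) 3
      (complexBetti.map (secantQuotientMap A hΘ G₁ G₂ hn h₁ h₂).hom.hom.hom 2 θ) ∧
    IsRationalClass γ ∧ γ ∉ (ℂ ∙ cupPowTwo θ 3) ∧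
    complexBetti.map (secantQuotientMap A hΘ G₁ G₂ hn h₁ h₂).hom.hom.hom (2 * 3) γ ∈
      weilClassesOf (A.prod (A.dualOf Θ hΘ)) (weilOperator hΘ hK d) 3 d ∧
    ∀ (X' : SchemeOver ℂ) (e : X' ≅ (secantQuotient A hΘ G₁ G₂ hn h₁ h₂).X),
      ∃ (I : Finset ℕ) (κ : (k : ℕ) → complexBetti X' (2 * k)) (c : ℕ → ℂ),
        3 ∈ I ∧ twistedReflexiveClass C Adm 6 X' I κ ∧
        κ 3 = complexBetti.map e.hom (2 * 3) γ + c 3 • cupPowTwo (complexBetti.map e.hom 2 θ) 3 ∧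
        ∀ k ∈ I, k ≠ 3 → κ k = c k • cupPowTwo (complexBetti.map e.hom 2 θ) k

/-- `HasTwistedCarrierOnSecantQuotient … ↔ ∃ θ γ, IsTwistedCarrierWeilPairOn … θ γ` — definitional.
[cite: Markman2025SecantWeil, §1.5 (p. 7)] -/
theorem hasTwistedCarrierOnSecantQuotient_iff (C : ChernCharacterBetti) (Adm : PerfectAdmissibility)
    (A : AbelianVariety ℂ) {Θ : CartierDivisor A.X.left} (hΘ : Θ.IsAmple) (hK : A.KTheta Θ = ⊥)
    (G₁ G₂ : Subgroup (A.Points ℂ)) {n : ℕ} (hn : n ≠ 0) (h₁ : G₁ ≤ A.torsionPoints ℂ n) (h₂ : G₂ ≤ A.torsionPoints ℂ n)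
    (d : ℕ) :
    HasTwistedCarrierOnSecantQuotient C Adm A hΘ hK G₁ G₂ hn h₁ h₂ d ↔
      ∃ (θ : complexBetti (secantQuotient A hΘ G₁ G₂ hn h₁ h₂).X 2)
        (γ : complexBetti (secantQuotient A hΘ G₁ G₂ hn h₁ h₂).X (2 * 3)),
        IsTwistedCarrierWeilPairOn C Adm A hΘ hK G₁ G₂ hn h₁ h₂ d θ γ :=
  Iff.rfl

/-- **The secant quotient carries a pinned twisted carrier of Weil shape AT THE DESCENDED WEIL POLARISATION `h_Y(θ₀)`**
(`HasPinnedTwistedCarrierOnSecantQuotient … d`): there are a polarisation class `θ₀` OF THE DIVISOR `Θ` on `A`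
(`AbelianVariety.IsPolarizationClassOf Θ θ₀`: rational, non-zero, on the line of `ch(Θ)`) and a class `γ` such that
`IsTwistedCarrierWeilPairOn … d (h_Y θ₀) γ`, `h_Y θ₀ = Markman2025.secantPolarizationClass A hΘ G₁ G₂ hn h₁ h₂ d θ₀` the descent of
`Ξ_d(θ₀) = p₁^*θ₀ + d·p₂^*θ̂₀`. The polarisation is thus PINNED (road gap G2 closed at the level of the statement); the served direction `γ`
stays existential (gap G3). A plain predicate. [cite: Markman2025SecantWeil, §1.3 (p. 5), §3.2 Cor. 3.2.3 and §1.5 (p. 7)] -/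
def HasPinnedTwistedCarrierOnSecantQuotient (C : ChernCharacterBetti) (Adm : PerfectAdmissibility)
    (A : AbelianVariety ℂ) {Θ : CartierDivisor A.X.left} (hΘ : Θ.IsAmple) (hK : A.KTheta Θ = ⊥)
    (G₁ G₂ : Subgroup (A.Points ℂ)) {n : ℕ} (hn : n ≠ 0) (h₁ : G₁ ≤ A.torsionPoints ℂ n) (h₂ : G₂ ≤ A.torsionPoints ℂ n)
    (d : ℕ) : Prop :=
  ∃ (θ₀ : complexBetti A.X 2) (γ : complexBetti (secantQuotient A hΘ G₁ G₂ hn h₁ h₂).X (2 * 3)),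
    A.IsPolarizationClassOf Θ θ₀ ∧
      IsTwistedCarrierWeilPairOn C Adm A hΘ hK G₁ G₂ hn h₁ h₂ d (secantPolarizationClass A hΘ G₁ G₂ hn h₁ h₂ d θ₀) γ

/-- **Markman 2025 (arXiv:2502.03415, UNREFEREED), the identified object-level statement WITH THE POLARISATION PINNED: for every EVEN
`d ≥ 4` there are a smooth projective complex curve `Cᵥ`, a Jacobian `𝒥` of `Cᵥ` with `dim J = 3`, a Riemann theta divisor `Θ` of `𝒥`
which is a principal polarization divisor, and cyclic subgroups `G₁, G₂ ≤ J[d+1](ℂ)` of order `d+1` with `G₁ ⊓ G₂ = ⊥` and the `(d+1)²`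
translates `τ_{g₁+g₂}(Θ)` in general position, such that `Y_d = (J × Ĵ)/Ḡ` with `φ_d` carries a pinned `Adm`-admissible twisted carrier of
Weil shape on every copy, polarised by the descended Weil polarisation `h_Y(θ₀)` of a polarisation class `θ₀` of `Θ`
(`HasPinnedTwistedCarrierOnSecantQuotient`)** — witness = that of `Markman2025_secantQuotient_twistedCarrier_onJacobian` (print's `(Y_d, h, γ₀, 𝓔̄)`
transported along `σ̄`), whose polarisation IS `σ̄^*h = h_Y(c·[Θ])`, `c ∈ ℚˣ` (section docstring: §1.3 rank-one invariant line, Prop. 2.4.4,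
Cor. 3.2.3, uniqueness of descent along `q^*`). ∃-FORM over print's construction data; regime `d` even `≥ 4` only; `Adm`-schema contract and
rendering glue (g1)–(g6) as in the module docstring. Implies the unpinned claim (forget `θ₀`; proved road-side). PREPRINT — UNREFEREED wherever
load-bearing. Users take `(h : Markman2025_secantQuotient_twistedCarrier_onJacobian_pinned C Adm)`. [claim: Markman2025SecantWeil, status: under-review] -/
def Markman2025_secantQuotient_twistedCarrier_onJacobian_pinned (C : ChernCharacterBetti) (Adm : PerfectAdmissibility) : Prop :=
  ∀ d : ℕ, Even d → 4 ≤ d →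
    ∃ (Cᵥ : SchemeOver ℂ) (_ : IsSmoothProjective 1 Cᵥ) (𝒥 : Jacobian Cᵥ) (_ : 𝒥.J.dim = 3)
      (Θ : CartierDivisor 𝒥.J.X.left) (_ : 𝒥.IsRiemannThetaDivisor Θ) (hP : 𝒥.J.IsPrincipalPolarizationDivisor Θ)
      (G₁ G₂ : Subgroup (𝒥.J.Points ℂ)) (h₁ : G₁ ≤ 𝒥.J.torsionPoints ℂ (d + 1 : ℕ))
      (h₂ : G₂ ≤ 𝒥.J.torsionPoints ℂ (d + 1 : ℕ)),
      IsCyclic G₁ ∧ Nat.card G₁ = d + 1 ∧ IsCyclic G₂ ∧ Nat.card G₂ = d + 1 ∧ G₁ ⊓ G₂ = ⊥ ∧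
      TranslatesInGeneralPosition 𝒥.J Θ (sumSet G₁ G₂) ∧
      HasPinnedTwistedCarrierOnSecantQuotient C Adm 𝒥.J hP.isAmple hP.KTheta_eq_bot G₁ G₂ (Nat.succ_ne_zero d) h₁ h₂ d

end HodgeTheory

end Literature.AlgebraicGeometry.HodgeTheory

end
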